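import Summits.CriticalPhenomena.SAWScalingLimit.Theorems.SAWDevelopingMapObservableToSLETypeLadderCarvedReductionSqueezeLimitData
import Summits.CriticalPhenomena.SAWScalingLimit.Theorems.SAWDevelopingMapObservableToSLETypeLadderCarvedReductionSqueezeGateFacts
import HarnessLib

/-!
# Extraction of the limit data: the super-domain and the gate windows (piece (T-A′₂F limit
# extraction) of stub T-A′₂F `stub_carvedReduction_squeezeGeometry_domainsCoreF`)

Crux `SAWDevelopingMap.ObservableToSLE` (stmt-CriticalPhenomena-10472), line `six-class-type-ladder`,
stub T-A′₂F `stub_carvedReduction_squeezeGeometry_domainsCoreF`.  Landing target: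
`Summits/CriticalPhenomena/SAWScalingLimit/Theorems/SAWDevelopingMapObservableToSLETypeLadderCarvedReductionSqueezeLimitExtract.lean`.

`squeezeLimit_extract`: from a `SqueezePkg` along `κ`, the realised gates, the clean-window
clauses of the carved families, and the D-level envelope data (`stub_carvedReduction_envelopeData`),
the full `SqueezeLimit` along the same `κ`: `ρ ≤ R` (`rho_le_R`), the super-domain with its
sequel clauses (`superSup`), the gate/body bookkeeping (`supGateData`), the unpinned exact windows
of radius `ρ` about the realised gates for the union of the two carved levels
(`exactWindow_union_of_clean`: the clean window of the realised gate controls its own level, the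
other level stays `R`-close to its root, far from the gate), the clean window balls and the wide
links.  Bookkeeping only.
Registered carrier: `stub_carvedReduction_limitExtract`.
-/

noncomputable section

open scoped Topology
open Filter Set Metric MeasureTheory
open Literature.Probability.LatticeModels (HexVertex hexGraph hexCenter triEmbed Site)
open Literature.Probability.RandomPlanarGeometry
open Literature.Probability.RandomPlanarGeometry.SAW
open ComplexConjugate

namespace Summit.CriticalPhenomena.SAWScalingLimit.Theorems.ObservableToSLE.TypeLadder

open Summit.CriticalPhenomena.SAWScalingLimit.Theorems.ObservableToSLER.BridgeGate
open Summit.CriticalPhenomena.SAWScalingLimit.Theorems.ObservableToSLER.NestedGate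
open Summit.CriticalPhenomena.SAWScalingLimit.Theorems.ObservableToSLER.TwoPiece

/-- **The exact window of the union**: the clean window of the realised gate (orientation `0`:
`rowOf 0 v = v.1 1`) controls its own level `A`; the other level `B` is `R`-close to a root more
than `R + ρ` away from the gate, hence off the window. -/
theorem exactWindow_union_of_clean {t ρ R : ℝ} {A B : Set HexVertex} {p q₀ c : HexVertex}
    (hwin : ∀ v : HexVertex, (t : ℂ) * hexCenter v ∈ ball ((t : ℂ) * hexCenter q₀) ρ → (v ∈ A ↔ rowOf 0 v ≤ rowOf 0 p))
    (hrow : rowOf 0 q₀ = rowOf 0 p + 1) (hB : ∀ v ∈ B, dist ((t : ℂ) * hexCenter v) ((t : ℂ) * hexCenter c) ≤ R)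
    (hfar : R + ρ < dist ((t : ℂ) * hexCenter q₀) ((t : ℂ) * hexCenter c)) :
    ∀ v : HexVertex, (t : ℂ) * hexCenter v ∈ ball ((t : ℂ) * hexCenter q₀) ρ → (v ∈ A ∪ B ↔ v.1 1 < q₀.1 1) := by
  intro v hv
  have hvB : v ∉ B := fun hvB => by
    have h1 := hB v hvB
    have h2 := mem_ball.1 hv
    linarith [dist_triangle ((t : ℂ) * hexCenter q₀) ((t : ℂ) * hexCenter v) ((t : ℂ) * hexCenter c), dist_comm ((t : ℂ) * hexCenter q₀) ((t : ℂ) * hexCenter v)]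
  rw [rowOf_zero, rowOf_zero] at hrow
  have key := hwin v hv
  rw [rowOf_zero, rowOf_zero] at key
  constructor
  · rintro (h | h)
    · have := key.1 h; omega
    · exact absurd h hvB
  · intro h; exact Or.inl (key.2 (by omega))

/-- **EXTRACTION OF THE LIMIT DATA**; see the module docstring. -/
theorem squeezeLimit_extract (D : DobrushinDomain) (a b : ℝ → HexVertex) (hab : IsEmbEndpointApprox hexGraph hexCenter D a b)
    {R ρ : ℝ} {N : ℕ} {δ : ℕ → ℝ} {S T : ℕ → ℕ → Set HexVertex} {n n' : ℕ → ℕ} {q q' : ℕ → HexVertex} (hρ : 0 < ρ)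
    (hsep : 2 * (R + ρ) < dist (D.pt 0) (D.pt 1))
    (hfam : ∀ k, TameNestedFamily (δ k) R N (a (δ k)) (S k) ∧ TameNestedFamily (δ k) R N (b (δ k)) (T k))
    (hwinS : ∀ k (i : ℕ) (p q₀ : HexVertex), HasCleanWindow D.carrier (δ k) ρ (S k i) p q₀ →
      rowOf 0 q₀ = rowOf 0 p + 1 ∧
        ∀ x : HexVertex, ((δ k : ℝ) : ℂ) * hexCenter x ∈ ball (((δ k : ℝ) : ℂ) * hexCenter q₀) ρ →
          (x ∈ S k i ↔ rowOf 0 x ≤ rowOf 0 p))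
    (hwinT : ∀ k (i : ℕ) (p q₀ : HexVertex), HasCleanWindow D.carrier (δ k) ρ (T k i) p q₀ →
      rowOf 0 q₀ = rowOf 0 p + 1 ∧
        ∀ x : HexVertex, ((δ k : ℝ) : ℂ) * hexCenter x ∈ ball (((δ k : ℝ) : ℂ) * hexCenter q₀) ρ →
          (x ∈ T k i ↔ rowOf 0 x ≤ rowOf 0 p))
    (hgates : ∀ k, ∃ (γ : HexDomainSAW D.carrier (δ k) (a (δ k)) (b (δ k))) (m : ℕ) (p : HexVertex)
        (m' : ℕ) (p' : HexVertex),
      IsFirstGoodGateN D.carrier (δ k) ρ R (S k) (a (δ k)) γ.walk.support (n k) m p (q k) ∧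
      IsFirstGoodGateN D.carrier (δ k) ρ R (T k) (b (δ k)) γ.walk.support.reverse (n' k) m' p' (q' k) ∧
      WideLink D.carrier (δ k) ρ (S k (n k) ∪ T k (n' k)) (q k) (q' k))
    (hq2 : ∀ k, (q k).2 = 0) (hq2' : ∀ k, (q' k).2 = 0)
    (H : ℂ ≃ₜ ℂ) (d : Fin 2 → ℂ) (β ε : ℝ) (hHd : ∀ i, H (d i) = D.pt i) (hHball : H '' ball 0 1 = D.carrier)
    (hHcl : H '' closedBall 0 1 = closure D.carrier) (hRε : R + ρ ≤ ε)
    (hcone : ∀ (τ' : ℂ) (i k : Fin 2), i ≠ k →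
      Disjoint ((H.trans (Homeomorph.addRight (-τ'))) ''
          {w : ℂ | 1 ≤ (w * conj (d k)).re ∧ (1 - β) * ‖w‖ ≤ (w * conj (d k)).re})
        (ball (H (d i) - τ') ε))
    (hexits : ∀ (τ' : ℂ) (ϱ₀ ζ : ℝ), 0 < ζ →
      ∃ (r₁ r₂ : ℝ) (J : JordanDomain) (η : Fin 2 → Set ℂ) (xx : Fin 2 → Fin 2 → ℂ) (F : Fin 2 → Set ℂ),
        1 < r₁ ∧ r₁ < r₂ ∧
        J.carrier = (H.trans (Homeomorph.addRight (-τ'))) '' ball 0 r₂ ∧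
        frontier J.carrier = (H.trans (Homeomorph.addRight (-τ'))) '' sphere 0 r₂ ∧
        closure ((fun z => z - τ') '' D.carrier) = (H.trans (Homeomorph.addRight (-τ'))) '' closedBall 0 1 ∧
        closure ((fun z => z - τ') '' D.carrier) ⊆ J.carrier ∧
        (∀ i, closedBall (D.pt i - τ') ϱ₀ ⊆ J.carrier) ∧
        (∀ i, J.IsCrosscut (η i) (xx i 0) (xx i 1)) ∧ (∀ i, η i \ {xx i 0, xx i 1} ⊆ F i) ∧
        (∀ i, IsOpen (F i)) ∧ (∀ i, IsConnected (F i)) ∧ (∀ i, F i ⊆ J.carrier) ∧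
        (∀ i, Disjoint (closure (F i)) ((H.trans (Homeomorph.addRight (-τ'))) '' closedBall 0 1)) ∧
        (∀ i, F i ⊆ (H.trans (Homeomorph.addRight (-τ'))) ''
          {w : ℂ | 1 ≤ (w * conj (d i)).re ∧ (1 - β) * ‖w‖ < (w * conj (d i)).re}) ∧
        Disjoint (F 0 ∪ {xx 0 0, xx 0 1}) (F 1 ∪ {xx 1 0, xx 1 1}) ∧
        (∀ i, ∃ z ∈ F i, dist z (D.pt i - τ') < ζ) ∧
        (∀ i k, xx i k ∈ frontier J.carrier))
    {κ : ℕ → ℕ} {τ P₀ P₁ : ℂ} (Pk : SqueezePkg D a b δ S T n n' q q' κ ρ R N τ P₀ P₁) :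
    Nonempty (SqueezeLimit D a b δ S T n n' q q' κ ρ R N) := by
  have hs0' : Tendsto (fun j => δ (κ j)) atTop (𝓝 0) := Pk.s0.mono_right nhdsWithin_le_nhds
  have hfamκ : ∀ j, TameNestedFamily (δ (κ j)) R N (a (δ (κ j))) (S (κ j)) ∧ TameNestedFamily (δ (κ j)) R N (b (δ (κ j))) (T (κ j)) :=
    fun j => hfam _
  -- the clean windows of the realised gates
  have hgate_data : ∀ j, ∃ p p' : HexVertex, HasCleanWindow D.carrier (δ (κ j)) ρ (S (κ j) (n (κ j))) p (q (κ j)) ∧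
      HasCleanWindow D.carrier (δ (κ j)) ρ (T (κ j) (n' (κ j))) p' (q' (κ j)) ∧
      WideLink D.carrier (δ (κ j)) ρ (S (κ j) (n (κ j)) ∪ T (κ j) (n' (κ j))) (q (κ j)) (q' (κ j)) ∧
      dist (((δ (κ j) : ℝ) : ℂ) * hexCenter (q (κ j))) (((δ (κ j) : ℝ) : ℂ) * hexCenter (a (δ (κ j)))) ≤ R + δ (κ j) := by
    intro j
    obtain ⟨γ, m, p, m', p', hgS, hgT, hw⟩ := hgates (κ j)
    exact ⟨p, p', hgS.1.2.2.1, hgT.1.2.2.1, hw, dist_gate_root_le (Pk.spos j).le γ.walk hgS (hfamκ j).1⟩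
  choose pg pg' hclS hclT hwide hdq using hgate_data
  -- `ρ ≤ R`
  have hρR : ρ ≤ R := rho_le_R (u := fun j => ((δ (κ j) : ℝ) : ℂ) * hexCenter (q (κ j)))
    (v := fun j => ((δ (κ j) : ℝ) : ℂ) * hexCenter (a (δ (κ j)))) hs0' (hab.tendsto_fst.comp Pk.s0)
    (fun h => (D.pt_mem_frontier 0).2 (by rwa [D.isOpen.interior_eq])) (fun j => (hclS j).1) hdq
  -- the super-domain and the gate bookkeeping
  obtain ⟨E, J, L, F, xx, hEpt0, hEpt1, hEflat, hEbox, hER, hEJ, hjoinE, hfrE, hDJ, hcross, hLcut, hFo, hFJ, hFD⟩ :=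
    superSup D a b hab δ ρ R N S T n n' q q' κ Pk.x τ P₀ P₁ H d β ε Pk.BS Pk.BT Pk.BpS Pk.BpT hρ hρR hRε hsep Pk.spos hs0'
      Pk.hτ hfamκ hgates hq2 hq2' Pk.hconv Pk.hconv' Pk.habove Pk.habove' Pk.hU Pk.hU' Pk.hballs Pk.hqdom hHd hcone hexits
      Pk.hBS Pk.hBT Pk.hBpS Pk.hBpT Pk.hHS Pk.hHT Pk.hbodyper
  obtain ⟨hPα, -, hconvq, hconvq', -, -, hup, hBfar, -, -, -, hBR, -⟩ :=
    supGateData D a b hab δ ρ R N S T n n' q q' κ Pk.x τ P₀ P₁ H d β ε Pk.BS Pk.BT Pk.BpS Pk.BpT hρ hρR hRε hsep Pk.spos hs0'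
      Pk.hτ hfamκ hgates hq2 hq2' Pk.hconv Pk.hconv' Pk.habove Pk.habove' Pk.hU Pk.hU' Pk.hballs Pk.hqdom hHd hcone hexits
      Pk.hBS Pk.hBT Pk.hBpS Pk.hBpT Pk.hHS Pk.hHT Pk.hbodyper
  -- the unpinned exact windows of the union
  have hα0 : dist (P₀ + τ) (D.pt 0) ≤ R := by simpa using hPα 0
  have hα1 : dist (P₁ + τ) (D.pt 1) ≤ R := by simpa using hPα 1
  have hfarT : ∀ᶠ j in atTop, R + ρ < dist (((δ (κ j) : ℝ) : ℂ) * hexCenter (q (κ j))) (((δ (κ j) : ℝ) : ℂ) * hexCenter (b (δ (κ j)))) := by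
    have hlim := Pk.hgate.dist (hab.tendsto_snd.comp Pk.s0)
    have hgt : R + ρ < dist (P₀ + τ) (D.pt 1) := by
      linarith [dist_triangle (D.pt 0) (P₀ + τ) (D.pt 1), dist_comm (D.pt 0) (P₀ + τ)]
    exact hlim.eventually (lt_mem_nhds hgt)
  have hfarS : ∀ᶠ j in atTop, R + ρ < dist (((δ (κ j) : ℝ) : ℂ) * hexCenter (q' (κ j))) (((δ (κ j) : ℝ) : ℂ) * hexCenter (a (δ (κ j)))) := by
    have hlim := Pk.hgate'.dist (hab.tendsto_fst.comp Pk.s0)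
    have hgt : R + ρ < dist (P₁ + τ) (D.pt 0) := by
      linarith [dist_triangle (D.pt 0) (P₁ + τ) (D.pt 1), dist_comm (P₁ + τ) (D.pt 0)]
    exact hlim.eventually (lt_mem_nhds hgt)
  have hwinq : ∀ᶠ j in atTop, ∀ v : HexVertex, ((δ (κ j) : ℝ) : ℂ) * hexCenter v ∈ ball (((δ (κ j) : ℝ) : ℂ) * hexCenter (q (κ j))) ρ →
      (v ∈ S (κ j) (n (κ j)) ∪ T (κ j) (n' (κ j)) ↔ v.1 1 < (q (κ j)).1 1) := by
    filter_upwards [hfarT] with j hj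
    obtain ⟨hrow, hw⟩ := hwinS (κ j) (n (κ j)) (pg j) (q (κ j)) (hclS j)
    exact exactWindow_union_of_clean hw hrow ((hfamκ j).2.2.2.1 _) hj
  have hwinq' : ∀ᶠ j in atTop, ∀ v : HexVertex, ((δ (κ j) : ℝ) : ℂ) * hexCenter v ∈ ball (((δ (κ j) : ℝ) : ℂ) * hexCenter (q' (κ j))) ρ →
      (v ∈ S (κ j) (n (κ j)) ∪ T (κ j) (n' (κ j)) ↔ v.1 1 < (q' (κ j)).1 1) := by
    filter_upwards [hfarS] with j hj v hv
    obtain ⟨hrow, hw⟩ := hwinT (κ j) (n' (κ j)) (pg' j) (q' (κ j)) (hclT j)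
    rw [union_comm]
    exact exactWindow_union_of_clean hw hrow ((hfamκ j).1.2.2.1 _) hj v hv
  exact ⟨{
    x := Pk.x, τ := τ, P₀ := P₀, P₁ := P₁, E := E, J := J, L := L, F := F, xx := xx, gS := Pk.gS, gT := Pk.gT,
    CS := Pk.CS, CT := Pk.CT, ϱS := Pk.ϱS, ϱT := Pk.ϱT, KS := Pk.KS, KT := Pk.KT, BS := Pk.BS, BT := Pk.BT,
    CcS := Pk.CcS, CcT := Pk.CcT, WS := Pk.WS, WT := Pk.WT, ϱcS := Pk.ϱcS, ϱcT := Pk.ϱcT, H := H,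
    hρ := hρ, hρR := hρR, hsep := hsep,
    spos := Pk.spos, santi := Pk.santi, s0 := Pk.s0, hτ := Pk.hτ, hq2 := fun j => hq2 _, hq2' := fun j => hq2' _,
    hconv := Pk.hconv, hconv' := Pk.hconv', habove := Pk.habove, habove' := Pk.habove', hU := Pk.hU, hU' := Pk.hU',
    hballs := Pk.hballs, hqdom := Pk.hqdom, hprob := Pk.hprob,
    hSroot := Pk.hSroot, hTroot := Pk.hTroot, hSloc := Pk.hSloc, hTloc := Pk.hTloc, hSpre := Pk.hSpre, hTpre := Pk.hTpre,
    hroot0 := Pk.hroot0, hroot1 := Pk.hroot1, hPα := hPα, hup := hup, hBfar := hBfar, hBR := hBR,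
    hLS := Pk.hLS, hLT := Pk.hLT, hϱS0 := Pk.hϱS0, hϱT0 := Pk.hϱT0, hCS := Pk.hCS, hradS := Pk.hradS, hCT := Pk.hCT,
    hradT := Pk.hradT, hpersS := Pk.hpersS, hpersT := Pk.hpersT, hcarve := Pk.hcarve, hKS := Pk.hKS, hKT := Pk.hKT,
    hKperS := Pk.hKperS, hKperT := Pk.hKperT, hBS := Pk.hBS, hBT := Pk.hBT, hBperS := fun ε hε => (Pk.hbodyper ε hε).mono
      fun j hj v hv => (hj v).1 hv, hBperT := fun ε hε => (Pk.hbodyper ε hε).mono fun j hj v hv => (hj v).2 hv,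
    hϱcS0 := Pk.hϱcS0, hϱcT0 := Pk.hϱcT0, hCcS := Pk.hCcS, hCcT := Pk.hCcT, hWS := Pk.hWS, hWT := Pk.hWT,
    hWKS := Pk.hWKS, hWKT := Pk.hWKT, hconnS := Pk.hconnS, hconnT := Pk.hconnT,
    hEpt0 := hEpt0, hEpt1 := hEpt1, hEflat := hEflat, hEbox := hEbox, hER := hER, hEJ := hEJ, hjoinE := hjoinE,
    hfrE := hfrE, hDJ := hDJ, hcross := hcross, hLcut := hLcut, hFo := hFo, hFJ := hFJ, hFD := hFD,
    hHball := hHball, hHcl := hHcl,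
    hwinq := hwinq, hwinq' := hwinq', hballq := Eventually.of_forall fun j => (hclS j).1,
    hballq' := Eventually.of_forall fun j => (hclT j).1, hwide := Eventually.of_forall hwide,
    hconvq := hconvq, hconvq' := hconvq' }⟩

/-- **Registered carrier `stub_carvedReduction_limitExtract`** (crux item stmt-CriticalPhenomena-10472,
stub T-A′₂F `stub_carvedReduction_squeezeGeometry_domainsCoreF`, piece THE LIMIT EXTRACTION): the
exact window of the union of the two carved levels about a realised gate. -/
theorem stub_carvedReduction_limitExtract :
    ∀ (t ρ R : ℝ) (A B : Set HexVertex) (p q₀ c : HexVertex),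
      (∀ v : HexVertex, (t : ℂ) * hexCenter v ∈ ball ((t : ℂ) * hexCenter q₀) ρ → (v ∈ A ↔ rowOf 0 v ≤ rowOf 0 p)) →
      rowOf 0 q₀ = rowOf 0 p + 1 → (∀ v ∈ B, dist ((t : ℂ) * hexCenter v) ((t : ℂ) * hexCenter c) ≤ R) →
      R + ρ < dist ((t : ℂ) * hexCenter q₀) ((t : ℂ) * hexCenter c) →
      ∀ v : HexVertex, (t : ℂ) * hexCenter v ∈ ball ((t : ℂ) * hexCenter q₀) ρ → (v ∈ A ∪ B ↔ v.1 1 < q₀.1 1) :=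
  fun _ _ _ _ _ _ _ _ hwin hrow hB hfar => exactWindow_union_of_clean hwin hrow hB hfar

end Summit.CriticalPhenomena.SAWScalingLimit.Theorems.ObservableToSLE.TypeLadder

end
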